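import Summits.NavierStokesRegularity.NavierStokesRegularity.Theorems.EfficiencyFloorNearSaturationNearMaximiserSeqCoreHeatUniform
import HarnessLib

/-!
# Route `EfficiencyFloor`, crux `NearSaturationNearMaximiser` (stmt-NavierStokesRegularity-25482) on the
# `ProductionEfficiencyDecay` ladder (stmt-22866): the local vorticity limit IS the curl of the weak-limit gradient

Def-free helper file, twenty-second of the group. In (I) of `nearSaturationNearMaximiser_of_identification` (`…SeqCoreHeatUniform`) the
local strong limit `Ω` of `curl v_{φ₀k}` is REDUNDANT data: it is almost everywhere the algebraic curl `Σⱼ eⱼ × M_j` of the weak-limit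
velocity gradient `(M_j)` (weak limits are unique; `curl` is a linear combination of gradient entries). Hence the by-name reduction of
stmt-25482 needs only (I'): «the weak `L²`-limit gradient field `(M_j)` of a centred normalised maximising subsequence is the gradient of an
ADMISSIBLE field `w`: `∂ⱼ w = M_j` a.e.» — existence, regularity and decay of the Lu–Doering extremising profile.

* `inner_cross_cyclic`, `curl_eq_sum_cross_fderiv` — `curl v x = Σⱼ eⱼ × (Dv x eⱼ)`;
* `ae_eq_zero_of_forall_integral_inner_testFields` — an `L²` field orthogonal to all `C_c` fields vanishes a.e.;
* `vorticityLimit_ae_eq_sum_cross` — `Ω = Σⱼ eⱼ × M_j` a.e.;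
* `nearSaturationNearMaximiser_of_gradientProfile` — BY NAME: stmt-25482 ⟸ (I').

HONEST FRAMING: (I') is NOT proved; stmt-25482, `LerayFloorGap`, `ProductionEfficiencyDecay` (stmt-22866) and Navier–Stokes regularity stay
OPEN; no summit statement is proved. [folklore]
-/

-- the problem directory repeats the summit name (`NavierStokesRegularity/NavierStokesRegularity`)
set_option linter.dupNamespace false

noncomputable section

namespace Summit.NavierStokesRegularity.NavierStokesRegularity.Theorems

namespace NearSaturationNearMaximiser

namespace SeqCore

open Set MeasureTheory Filter Topology Function Real
open scoped InnerProductSpace ENNReal NNReal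
open Literature.Analysis.FluidPDE

/-! ## §1 `curl v = Σⱼ eⱼ × ∂ⱼ v` -/

/-- The scalar triple product is cyclic: `⟪m, a × e⟫ = ⟪a, e × m⟫`. [folklore] -/
theorem inner_cross_cyclic (m a e : EuclideanSpace ℝ (Fin 3)) : ⟪m, cross a e⟫_ℝ = ⟪a, cross e m⟫_ℝ := by
  simp only [cross, PiLp.inner_apply, RCLike.inner_apply, conj_trivial, Fin.sum_univ_three, cross_apply, Matrix.cons_val_zero,
    Matrix.cons_val_one, Matrix.cons_val_two, Matrix.head_cons, Matrix.tail_cons]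
  ring

/-- `curl v x = Σⱼ eⱼ × (Dv x eⱼ)` over the standard basis (every `v`, junk values included). [folklore] -/
theorem curl_eq_sum_cross_fderiv (v : EuclideanSpace ℝ (Fin 3) → EuclideanSpace ℝ (Fin 3)) (x : EuclideanSpace ℝ (Fin 3)) :
    curl v x = ∑ j, cross (EuclideanSpace.basisFun (Fin 3) ℝ j) (fderiv ℝ v x (EuclideanSpace.basisFun (Fin 3) ℝ j)) := by
  refine ext_inner_right ℝ fun a => ?_
  rw [inner_curl_eq_sum_inner_fderiv_cross v x a, sum_inner]
  refine Finset.sum_congr rfl fun j _ => ?_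
  rw [inner_cross_cyclic, real_inner_comm]

/-! ## §2 Uniqueness of weak limits -/

/-- An `L²` field whose pairings against all continuous compactly supported fields vanish is zero a.e. (density). [folklore] -/
theorem ae_eq_zero_of_forall_integral_inner_testFields {f : EuclideanSpace ℝ (Fin 3) → EuclideanSpace ℝ (Fin 3)}
    (hf : MemLp f 2 volume)
    (h0 : ∀ ψ : EuclideanSpace ℝ (Fin 3) → EuclideanSpace ℝ (Fin 3), Continuous ψ → HasCompactSupport ψ → ∫ x, ⟪f x, ψ x⟫_ℝ = 0) :
    f =ᵐ[volume] 0 := by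
  have hf' : MemLp f (ENNReal.ofReal ((2 : ℕ) : ℝ)) volume := by rwa [show ((2 : ℕ) : ℝ) = 2 by norm_num, ENNReal.ofReal_ofNat]
  have I2 : Integrable (fun x => ‖f x‖ ^ 2) := integrable_norm_sq_of_memLp_two hf
  -- the constant sequence `f` converges weakly to `0` against test fields, hence against `f` itself
  have h := tendsto_integral_inner_of_testFields holderConjugate_two (f := fun _ : ℕ => f) (C := ∫ x, ‖f x‖ ^ 2)
    (fun _ => hf') (fun _ => by rw [integral_norm_rpow_natCast]) (fun ψ hψ hψc _ => by
      rw [h0 ψ hψ hψc]; exact tendsto_const_nhds) hf'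
  have hlim : (∫ x, ⟪f x, f x⟫_ℝ) = 0 := tendsto_nhds_unique tendsto_const_nhds h
  have hsq : ∫ x, ‖f x‖ ^ 2 = 0 := by
    rw [← hlim]; exact integral_congr_ae (ae_of_all _ fun x => (real_inner_self_eq_norm_sq (f x)).symm)
  have hae := (integral_eq_zero_iff_of_nonneg (fun x => by positivity) I2).1 hsq
  exact hae.mono fun x hx => by simpa using hx

/-! ## §3 The local vorticity limit is the curl of the weak-limit gradient -/

/-- **`Ω = Σⱼ eⱼ × M_j` almost everywhere.** Along admissible `v_k`, if `∂ⱼ v_k ⇀ M_j` weakly in `L²` and `curl v_k → Ω` in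
`L²(B(0,R))` for every `R`, with `M_j, Ω ∈ L²`, then `Ω` agrees a.e. with the algebraic curl of `(M_j)`. [folklore] -/
theorem vorticityLimit_ae_eq_sum_cross {u : ℕ → EuclideanSpace ℝ (Fin 3) → EuclideanSpace ℝ (Fin 3)}
    (hu : ∀ k, ContDiff ℝ (⊤ : ℕ∞) (u k) ∧ VectorCalculus.IsDivFree (u k) ∧ (∫⁻ x, ‖iteratedFDeriv ℝ 0 (u k) x‖ₑ ^ 2 < ⊤) ∧
      (∫⁻ x, ‖iteratedFDeriv ℝ 1 (u k) x‖ₑ ^ 2 < ⊤) ∧ (∫⁻ x, ‖iteratedFDeriv ℝ 2 (u k) x‖ₑ ^ 2 < ⊤))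
    {M : Fin 3 → EuclideanSpace ℝ (Fin 3) → EuclideanSpace ℝ (Fin 3)} (hM : ∀ j, MemLp (M j) 2 volume)
    (hconv : ∀ (j : Fin 3) (ψ : EuclideanSpace ℝ (Fin 3) → EuclideanSpace ℝ (Fin 3)), MemLp ψ 2 volume →
      Tendsto (fun k => ∫ x, ⟪fderiv ℝ (u k) x (EuclideanSpace.basisFun (Fin 3) ℝ j), ψ x⟫_ℝ) atTop (𝓝 (∫ x, ⟪M j x, ψ x⟫_ℝ)))
    {Ω : EuclideanSpace ℝ (Fin 3) → EuclideanSpace ℝ (Fin 3)} (hΩ : MemLp Ω 2 volume)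
    (hloc : ∀ R : ℝ, 0 < R → Tendsto (fun k => ∫ x in Metric.ball (0 : EuclideanSpace ℝ (Fin 3)) R, ‖curl (u k) x - Ω x‖ ^ 2)
      atTop (𝓝 0)) :
    Ω =ᵐ[volume] fun x => ∑ j, cross (EuclideanSpace.basisFun (Fin 3) ℝ j) (M j x) := by
  have e2 : ENNReal.ofReal ((2 : ℕ) : ℝ) = 2 := by norm_num
  obtain ⟨Ω', hΩ'⟩ : ∃ Ω' : EuclideanSpace ℝ (Fin 3) → EuclideanSpace ℝ (Fin 3),
      Ω' = fun x => ∑ j, cross (EuclideanSpace.basisFun (Fin 3) ℝ j) (M j x) := ⟨_, rfl⟩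
  -- `Ω' ∈ L²`
  have hΩ'm : MemLp Ω' 2 volume := by
    rw [hΩ']
    exact memLp_finsetSum _ fun j _ => (crossCLM (EuclideanSpace.basisFun (Fin 3) ℝ j)).comp_memLp' (hM j)
  -- the test fields `x ↦ ψ x × eⱼ` are in `L²`
  have hψj : ∀ (ψ : EuclideanSpace ℝ (Fin 3) → EuclideanSpace ℝ (Fin 3)), MemLp ψ 2 volume → ∀ j,
      MemLp (fun x => cross (ψ x) (EuclideanSpace.basisFun (Fin 3) ℝ j)) 2 volume := fun ψ hψ j =>
    (crossCLM.flip (EuclideanSpace.basisFun (Fin 3) ℝ j)).comp_memLp' hψ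
  -- (a) weak convergence of `curl u_k` to `Ω'` against `L²` fields
  have hD2 : ∀ k j, MemLp (fun x => fderiv ℝ (u k) x (EuclideanSpace.basisFun (Fin 3) ℝ j)) 2 volume := fun k j => by
    have h := (memLp_two_fderiv_apply (hu k).1 (hu k).2.2.2.1 (hu k).2.2.2.2 (e := EuclideanSpace.basisFun (Fin 3) ℝ j) (by simp)).2.2
    rwa [e2] at h
  have hweak' : ∀ ψ : EuclideanSpace ℝ (Fin 3) → EuclideanSpace ℝ (Fin 3), MemLp ψ 2 volume →
      Tendsto (fun k => ∫ x, ⟪curl (u k) x, ψ x⟫_ℝ) atTop (𝓝 (∫ x, ⟪Ω' x, ψ x⟫_ℝ)) := by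
    intro ψ hψ
    have Ikj : ∀ k j, Integrable (fun x => ⟪fderiv ℝ (u k) x (EuclideanSpace.basisFun (Fin 3) ℝ j),
        cross (ψ x) (EuclideanSpace.basisFun (Fin 3) ℝ j)⟫_ℝ) := fun k j =>
      integrable_inner_of_memLp holderConjugate_two (by rw [e2]; exact hD2 k j) (by rw [e2]; exact hψj ψ hψ j)
    have IMj : ∀ j, Integrable (fun x => ⟪M j x, cross (ψ x) (EuclideanSpace.basisFun (Fin 3) ℝ j)⟫_ℝ) := fun j =>
      integrable_inner_of_memLp holderConjugate_two (by rw [e2]; exact hM j) (by rw [e2]; exact hψj ψ hψ j)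
    have hsum := tendsto_finsetSum (Finset.univ : Finset (Fin 3)) fun j _ =>
      hconv j (fun x => cross (ψ x) (EuclideanSpace.basisFun (Fin 3) ℝ j)) (hψj ψ hψ j)
    have e1 : ∀ k, (∫ x, ⟪curl (u k) x, ψ x⟫_ℝ) = ∑ j, ∫ x, ⟪fderiv ℝ (u k) x (EuclideanSpace.basisFun (Fin 3) ℝ j),
        cross (ψ x) (EuclideanSpace.basisFun (Fin 3) ℝ j)⟫_ℝ := fun k => by
      rw [← integral_finsetSum _ (fun j _ => Ikj k j)]
      exact integral_congr_ae (ae_of_all _ fun x => inner_curl_eq_sum_inner_fderiv_cross (u k) x (ψ x))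
    have e3 : (∫ x, ⟪Ω' x, ψ x⟫_ℝ) = ∑ j, ∫ x, ⟪M j x, cross (ψ x) (EuclideanSpace.basisFun (Fin 3) ℝ j)⟫_ℝ := by
      rw [← integral_finsetSum _ (fun j _ => IMj j)]
      refine integral_congr_ae (ae_of_all _ fun x => ?_)
      show ⟪Ω' x, ψ x⟫_ℝ = ∑ j, ⟪M j x, cross (ψ x) (EuclideanSpace.basisFun (Fin 3) ℝ j)⟫_ℝ
      rw [hΩ', sum_inner]
      refine Finset.sum_congr rfl fun j _ => ?_
      rw [real_inner_comm, inner_cross_cyclic, inner_cross_cyclic]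
    rw [e3]
    exact hsum.congr fun k => (e1 k).symm
  -- (b) local strong convergence gives the weak limit `Ω` against `C_c` fields
  have hweakΩ : ∀ ψ : EuclideanSpace ℝ (Fin 3) → EuclideanSpace ℝ (Fin 3), Continuous ψ → HasCompactSupport ψ →
      Tendsto (fun k => ∫ x, ⟪curl (u k) x - Ω x, ψ x⟫_ℝ) atTop (𝓝 0) := by
    intro ψ hψ hψc
    obtain ⟨R₀, hR₀⟩ := hψc.isCompact.isBounded.subset_closedBall (0 : EuclideanSpace ℝ (Fin 3))
    set R : ℝ := max R₀ 0 + 1 with hR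
    have hRpos : 0 < R := by rw [hR]; positivity
    have hsub : tsupport ψ ⊆ Metric.ball (0 : EuclideanSpace ℝ (Fin 3)) R := fun x hx => by
      have h := hR₀ hx
      rw [Metric.mem_closedBall] at h
      rw [Metric.mem_ball, hR]
      linarith [le_max_left R₀ 0]
    have hψm : MemLp ψ 2 volume := hψ.memLp_of_hasCompactSupport hψc
    have hcurl2 : ∀ k, MemLp (curl (u k)) 2 volume := fun k => by
      have h := memLp_two_curl (hu k).1 (hu k).2.2.2.1; rwa [e2] at h
    -- Cauchy–Schwarz on the ball
    have hb : ∀ k, |∫ x, ⟪curl (u k) x - Ω x, ψ x⟫_ℝ| ≤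
        (∫ x in Metric.ball (0 : EuclideanSpace ℝ (Fin 3)) R, ‖curl (u k) x - Ω x‖ ^ 2) ^ (1 / (2 : ℝ)) *
          (∫ x in Metric.ball (0 : EuclideanSpace ℝ (Fin 3)) R, ‖ψ x‖ ^ 2) ^ (1 / (2 : ℝ)) := by
      intro k
      have hz : ∀ x, x ∉ Metric.ball (0 : EuclideanSpace ℝ (Fin 3)) R → ⟪curl (u k) x - Ω x, ψ x⟫_ℝ = 0 := fun x hx => by
        rw [image_eq_zero_of_notMem_tsupport (fun h => hx (hsub h)), inner_zero_right]
      rw [← setIntegral_eq_integral_of_forall_compl_eq_zero hz]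
      have m1 : MemLp (fun x => curl (u k) x - Ω x) (ENNReal.ofReal 2) (volume.restrict (Metric.ball 0 R)) := by
        rw [ENNReal.ofReal_ofNat]; exact ((hcurl2 k).sub hΩ).restrict _
      have m2 : MemLp ψ (ENNReal.ofReal 2) (volume.restrict (Metric.ball (0 : EuclideanSpace ℝ (Fin 3)) R)) := by
        rw [ENNReal.ofReal_ofNat]; exact hψm.restrict _
      have hH := integral_mul_norm_le_Lp_mul_Lq (μ := volume.restrict (Metric.ball (0 : EuclideanSpace ℝ (Fin 3)) R))
        Real.HolderConjugate.two_two m1 m2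
      have e1 : ∫ x in Metric.ball (0 : EuclideanSpace ℝ (Fin 3)) R, ‖curl (u k) x - Ω x‖ ^ (2 : ℝ) =
          ∫ x in Metric.ball (0 : EuclideanSpace ℝ (Fin 3)) R, ‖curl (u k) x - Ω x‖ ^ 2 :=
        integral_congr_ae (ae_of_all _ fun x => by simp only [Real.rpow_two])
      have e2' : ∫ x in Metric.ball (0 : EuclideanSpace ℝ (Fin 3)) R, ‖ψ x‖ ^ (2 : ℝ) =
          ∫ x in Metric.ball (0 : EuclideanSpace ℝ (Fin 3)) R, ‖ψ x‖ ^ 2 :=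
        integral_congr_ae (ae_of_all _ fun x => by simp only [Real.rpow_two])
      rw [e1, e2'] at hH
      refine le_trans ?_ hH
      refine (abs_integral_le_integral_abs).trans (integral_mono_of_nonneg (ae_of_all _ fun x => abs_nonneg _) ?_
        (ae_of_all _ fun x => abs_real_inner_le_norm _ _))
      haveI := Real.HolderConjugate.two_two.ennrealOfReal
      exact m1.norm.integrable_mul m2.norm
    -- squeeze
    have h0 : Tendsto (fun k => (∫ x in Metric.ball (0 : EuclideanSpace ℝ (Fin 3)) R, ‖curl (u k) x - Ω x‖ ^ 2) ^ (1 / (2 : ℝ)) *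
        (∫ x in Metric.ball (0 : EuclideanSpace ℝ (Fin 3)) R, ‖ψ x‖ ^ 2) ^ (1 / (2 : ℝ))) atTop (𝓝 0) := by
      have h := ((hloc R hRpos).rpow_const (p := 1 / (2 : ℝ)) (Or.inr (by norm_num))).mul_const
        ((∫ x in Metric.ball (0 : EuclideanSpace ℝ (Fin 3)) R, ‖ψ x‖ ^ 2) ^ (1 / (2 : ℝ)))
      rwa [Real.zero_rpow (by norm_num), zero_mul] at h
    rw [tendsto_zero_iff_abs_tendsto_zero]
    exact tendsto_of_tendsto_of_tendsto_of_le_of_le tendsto_const_nhds h0 (fun k => abs_nonneg _) hb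
  -- (c) `Ω − Ω'` is orthogonal to all test fields, hence zero a.e.
  have horth : ∀ ψ : EuclideanSpace ℝ (Fin 3) → EuclideanSpace ℝ (Fin 3), Continuous ψ → HasCompactSupport ψ →
      ∫ x, ⟪Ω x - Ω' x, ψ x⟫_ℝ = 0 := by
    intro ψ hψ hψc
    have hψm : MemLp ψ 2 volume := hψ.memLp_of_hasCompactSupport hψc
    have hcurl2 : ∀ k, MemLp (curl (u k)) 2 volume := fun k => by
      have h := memLp_two_curl (hu k).1 (hu k).2.2.2.1; rwa [e2] at h
    have Ic : ∀ k, Integrable (fun x => ⟪curl (u k) x, ψ x⟫_ℝ) := fun k =>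
      integrable_inner_of_memLp holderConjugate_two (by rw [e2]; exact hcurl2 k) (by rw [e2]; exact hψm)
    have IΩ : Integrable (fun x => ⟪Ω x, ψ x⟫_ℝ) := integrable_inner_of_memLp holderConjugate_two (by rw [e2]; exact hΩ) (by rw [e2]; exact hψm)
    have IΩ' : Integrable (fun x => ⟪Ω' x, ψ x⟫_ℝ) :=
      integrable_inner_of_memLp holderConjugate_two (by rw [e2]; exact hΩ'm) (by rw [e2]; exact hψm)
    -- `∫⟪curl u_k, ψ⟫ → ∫⟪Ω, ψ⟫` and `→ ∫⟪Ω', ψ⟫`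
    have h1 : Tendsto (fun k => ∫ x, ⟪curl (u k) x, ψ x⟫_ℝ) atTop (𝓝 (∫ x, ⟪Ω x, ψ x⟫_ℝ)) := by
      have h := (hweakΩ ψ hψ hψc).add_const (∫ x, ⟪Ω x, ψ x⟫_ℝ)
      rw [zero_add] at h
      refine h.congr fun k => ?_
      rw [← integral_add ((Ic k).sub IΩ |>.congr (ae_of_all _ fun x => by
        show ⟪curl (u k) x, ψ x⟫_ℝ - ⟪Ω x, ψ x⟫_ℝ = ⟪curl (u k) x - Ω x, ψ x⟫_ℝ
        rw [inner_sub_left])) IΩ]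
      refine integral_congr_ae (ae_of_all _ fun x => ?_)
      show ⟪curl (u k) x - Ω x, ψ x⟫_ℝ + ⟪Ω x, ψ x⟫_ℝ = ⟪curl (u k) x, ψ x⟫_ℝ
      rw [inner_sub_left, sub_add_cancel]
    have h2 := hweak' ψ hψm
    have heq : (∫ x, ⟪Ω x, ψ x⟫_ℝ) = ∫ x, ⟪Ω' x, ψ x⟫_ℝ := tendsto_nhds_unique h1 h2
    have e : (∫ x, ⟪Ω x - Ω' x, ψ x⟫_ℝ) = (∫ x, ⟪Ω x, ψ x⟫_ℝ) - ∫ x, ⟪Ω' x, ψ x⟫_ℝ := by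
      rw [← integral_sub IΩ IΩ']
      exact integral_congr_ae (ae_of_all _ fun x => by
        show ⟪Ω x - Ω' x, ψ x⟫_ℝ = ⟪Ω x, ψ x⟫_ℝ - ⟪Ω' x, ψ x⟫_ℝ
        rw [inner_sub_left])
    rw [e, heq, sub_self]
  have hz := ae_eq_zero_of_forall_integral_inner_testFields (hΩ.sub hΩ'm) horth
  rw [← hΩ']
  exact hz.mono fun x hx => sub_eq_zero.1 (by simpa using hx)

/-! ## §4 By name: stmt-25482 from the gradient profile alone -/

/-- **`NearSaturationNearMaximiser` (stmt-25482) from the identification of the weak-limit GRADIENT alone, BY NAME.** (I') — for the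
sharp constant, along every centred normalised maximising sequence and every subsequence `φ₀` on which the velocity gradients
`∂ⱼ v_{φ₀k}` converge weakly in `L²` to `M_j`, there is an ADMISSIBLE `w` with `∂ⱼ w = M_j` a.e. The local vorticity limit needed by
`nearSaturationNearMaximiser_of_identification` is then automatically `curl w` (`vorticityLimit_ae_eq_sum_cross`). [folklore] -/
theorem nearSaturationNearMaximiser_of_gradientProfile
    (HI : ∀ c : ℝ, (0 < c ∧ (∀ v : EuclideanSpace ℝ (Fin 3) → EuclideanSpace ℝ (Fin 3), (ContDiff ℝ (⊤ : ℕ∞) v ∧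
      Literature.Analysis.FluidPDE.VectorCalculus.IsDivFree v ∧ (∫⁻ x, ‖iteratedFDeriv ℝ 0 v x‖ₑ ^ 2 < ⊤) ∧
      (∫⁻ x, ‖iteratedFDeriv ℝ 1 v x‖ₑ ^ 2 < ⊤) ∧ (∫⁻ x, ‖iteratedFDeriv ℝ 2 v x‖ₑ ^ 2 < ⊤)) → (∫ x,
      ⟪Literature.Analysis.FluidPDE.curl v x, fderiv ℝ v x (Literature.Analysis.FluidPDE.curl v x)⟫_ℝ) ≤ c *
      (∫ x, ‖Literature.Analysis.FluidPDE.curl v x‖ ^ 2) ^ (3 / 4 : ℝ) * (∫ x,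
      Literature.Analysis.FluidPDE.frobeniusNormSq (fderiv ℝ (Literature.Analysis.FluidPDE.curl v) x)) ^ (3 / 4 : ℝ)) ∧ ∀ c' : ℝ, (∀ w : EuclideanSpace ℝ (Fin 3) → EuclideanSpace ℝ (Fin 3), (ContDiff ℝ (⊤ : ℕ∞) w ∧
      Literature.Analysis.FluidPDE.VectorCalculus.IsDivFree w ∧ (∫⁻ x, ‖iteratedFDeriv ℝ 0 w x‖ₑ ^ 2 < ⊤) ∧
      (∫⁻ x, ‖iteratedFDeriv ℝ 1 w x‖ₑ ^ 2 < ⊤) ∧ (∫⁻ x, ‖iteratedFDeriv ℝ 2 w x‖ₑ ^ 2 < ⊤)) → (∫ x,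
      ⟪Literature.Analysis.FluidPDE.curl w x, fderiv ℝ w x (Literature.Analysis.FluidPDE.curl w x)⟫_ℝ) ≤ c' *
      (∫ x, ‖Literature.Analysis.FluidPDE.curl w x‖ ^ 2) ^ (3 / 4 : ℝ) * (∫ x,
      Literature.Analysis.FluidPDE.frobeniusNormSq (fderiv ℝ (Literature.Analysis.FluidPDE.curl w) x)) ^ (3 / 4 : ℝ)) → c ≤ c') →
      ∀ K δ : ℝ, 0 < K → 0 < δ → ∀ v : ℕ → EuclideanSpace ℝ (Fin 3) → EuclideanSpace ℝ (Fin 3),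
      (∀ n, (ContDiff ℝ (⊤ : ℕ∞) (v n) ∧
      Literature.Analysis.FluidPDE.VectorCalculus.IsDivFree (v n) ∧ (∫⁻ x, ‖iteratedFDeriv ℝ 0 (v n) x‖ₑ ^ 2 < ⊤) ∧
      (∫⁻ x, ‖iteratedFDeriv ℝ 1 (v n) x‖ₑ ^ 2 < ⊤) ∧ (∫⁻ x, ‖iteratedFDeriv ℝ 2 (v n) x‖ₑ ^ 2 < ⊤))) →
      (∀ n, (∫ x, ‖Literature.Analysis.FluidPDE.curl (v n) x‖ ^ 2) = 1) →
      (∀ n, (∫ x, Literature.Analysis.FluidPDE.frobeniusNormSq (fderiv ℝ (Literature.Analysis.FluidPDE.curl (v n)) x)) = 1) →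
      Tendsto (fun n => ∫ x, ⟪Literature.Analysis.FluidPDE.curl (v n) x, fderiv ℝ (v n) x
        (Literature.Analysis.FluidPDE.curl (v n) x)⟫_ℝ) atTop (𝓝 c) →
      (∀ᶠ n in atTop, δ ≤ ∫ x in Metric.ball (0 : EuclideanSpace ℝ (Fin 3)) K, ‖Literature.Analysis.FluidPDE.curl (v n) x‖ ^ 2) →
      ∀ (φ₀ : ℕ → ℕ) (M : Fin 3 → EuclideanSpace ℝ (Fin 3) → EuclideanSpace ℝ (Fin 3)), StrictMono φ₀ →
      (∀ j, MemLp (M j) 2 volume) →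
      (∀ (j : Fin 3) (ψ : EuclideanSpace ℝ (Fin 3) → EuclideanSpace ℝ (Fin 3)), MemLp ψ 2 volume →
        Tendsto (fun k => ∫ x, ⟪fderiv ℝ (v (φ₀ k)) x (EuclideanSpace.basisFun (Fin 3) ℝ j), ψ x⟫_ℝ) atTop
          (𝓝 (∫ x, ⟪M j x, ψ x⟫_ℝ))) →
      ∃ w : EuclideanSpace ℝ (Fin 3) → EuclideanSpace ℝ (Fin 3), (ContDiff ℝ (⊤ : ℕ∞) w ∧
      Literature.Analysis.FluidPDE.VectorCalculus.IsDivFree w ∧ (∫⁻ x, ‖iteratedFDeriv ℝ 0 w x‖ₑ ^ 2 < ⊤) ∧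
      (∫⁻ x, ‖iteratedFDeriv ℝ 1 w x‖ₑ ^ 2 < ⊤) ∧ (∫⁻ x, ‖iteratedFDeriv ℝ 2 w x‖ₑ ^ 2 < ⊤)) ∧
        (∀ j : Fin 3, (fun x => fderiv ℝ w x (EuclideanSpace.basisFun (Fin 3) ℝ j)) =ᵐ[volume] M j)) :
    Summit.NavierStokesRegularity.NavierStokesRegularity.Theses.EfficiencyFloor.NearSaturationNearMaximiser := by
  refine nearSaturationNearMaximiser_of_identification
    fun c hsharp K δ hK hδ v hAdm hZ1 hP1 hS hcen φ₀ M Ω hφ₀ hM hconv hΩ hlocΩ => ?_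
  obtain ⟨w, hw, hMw⟩ := HI c hsharp K δ hK hδ v hAdm hZ1 hP1 hS hcen φ₀ M hφ₀ hM hconv
  refine ⟨w, hw, hMw, ?_⟩
  -- `curl w = Σⱼ eⱼ × ∂ⱼw =ᵐ Σⱼ eⱼ × M_j =ᵐ Ω`
  have hΩ' := vorticityLimit_ae_eq_sum_cross (u := fun k => v (φ₀ k)) (fun k => hAdm (φ₀ k)) hM hconv hΩ hlocΩ
  have hall : ∀ᵐ x ∂volume, ∀ j : Fin 3, fderiv ℝ w x (EuclideanSpace.basisFun (Fin 3) ℝ j) = M j x :=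
    eventually_all.2 fun j => (hMw j).mono fun x hx => hx
  filter_upwards [hΩ', hall] with x hx hx'
  rw [hx, curl_eq_sum_cross_fderiv]
  exact Finset.sum_congr rfl fun j _ => by rw [hx' j]

end SeqCore

end NearSaturationNearMaximiser

end Summit.NavierStokesRegularity.NavierStokesRegularity.Theorems

end
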